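import Summits.NavierStokesRegularity.NavierStokesRegularity.Theorems.HodographBetchovSlowClassProductionSingularGerm

/-!
# `SlowClassProduction` (stmt-NavierStokesRegularity-15831) — the near-field stub ⟺ the singular-germ statement; no blow-up ⇒ crux

Route `HodographBetchov`, crux 2, line `near_field`.  Companion to
`HodographBetchovSlowClassProductionSingularGerm.lean`:

* `germBudget_of_nearFieldBudget` — near-field budgets restrict to germ budgets at every point (a
  germ region `{T − ρ ≤ s} × B(x₀, ρ)`, `ρ = T/2`, is a near-field layer);
* `nearFieldBudget_iff_singularGermBudget` — the statement of the line's open stub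
  `stub_nearFieldSlowProductionMaximal` is EQUIVALENT to the singular-germ statement (absolute germ
  budgets at singular, `l`-slow-accumulating points of maximal solutions);
* `slowClassProduction_of_noBlowup` — the crux follows from the no-blow-up hypothesis of the tree's
  `navierStokesRegularity_of_noBlowup` (item 0055), by the landed
  `slowClassBudget_of_hasSmoothExtensionPast`: refuting the crux refutes no-blow-up.
-/

noncomputable section

-- the summit and its single problem share the name `NavierStokesRegularity` (D-0017 nested layout)
set_option linter.dupNamespace false

namespace Summit.NavierStokesRegularity.NavierStokesRegularity.Theorems.SlowClassProduction.NearField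

open Set MeasureTheory Function Metric Filter Topology Literature.Analysis.FluidPDE
open scoped ENNReal NNReal

/-! ## Germ budgets from near-field budgets -/

/-- **The converse restriction: near-field budgets give germ budgets at every point** (a germ region
`{T − ρ ≤ s} × B(x₀, ρ)` with `ρ ≤ T/2` lies in the near-field layer `(h, R) = (ρ, ‖x₀‖ + ρ)`).
[folklore] -/
theorem germBudget_of_nearFieldBudget {T : ℝ} (hT : 0 < T)
    {u : ℝ → EuclideanSpace ℝ (Fin 3) → EuclideanSpace ℝ (Fin 3)} {l : ℝ}
    (hnear : ∀ h : ℝ, 0 < h → h < T → ∀ R : ℝ, ∃ C : ℝ, ∀ t ∈ Set.Ico 0 T,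
      MeasureTheory.IntegrableOn
        (fun z : ℝ × EuclideanSpace ℝ (Fin 3) =>
          inner ℝ (Literature.Analysis.FluidPDE.curl (u z.1) z.2)
            (fderiv ℝ (u z.1) z.2 (Literature.Analysis.FluidPDE.curl (u z.1) z.2)))
        ({z : ℝ × EuclideanSpace ℝ (Fin 3) | z.1 ∈ Set.Ioo 0 t ∧ ‖u z.1 z.2‖ ≤ l} ∩
          {z : ℝ × EuclideanSpace ℝ (Fin 3) | T - h ≤ z.1 ∧ ‖z.2‖ < R}) ∧
      ∫ z in ({z : ℝ × EuclideanSpace ℝ (Fin 3) | z.1 ∈ Set.Ioo 0 t ∧ ‖u z.1 z.2‖ ≤ l} ∩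
          {z : ℝ × EuclideanSpace ℝ (Fin 3) | T - h ≤ z.1 ∧ ‖z.2‖ < R}),
        |inner ℝ (Literature.Analysis.FluidPDE.curl (u z.1) z.2)
          (fderiv ℝ (u z.1) z.2 (Literature.Analysis.FluidPDE.curl (u z.1) z.2))| ≤ C)
    (x₀ : EuclideanSpace ℝ (Fin 3)) :
    ∃ ρ : ℝ, 0 < ρ ∧ ∃ C : ℝ, ∀ t ∈ Set.Ico 0 T,
      MeasureTheory.IntegrableOn
        (fun z : ℝ × EuclideanSpace ℝ (Fin 3) =>
          inner ℝ (Literature.Analysis.FluidPDE.curl (u z.1) z.2)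
            (fderiv ℝ (u z.1) z.2 (Literature.Analysis.FluidPDE.curl (u z.1) z.2)))
        ({z : ℝ × EuclideanSpace ℝ (Fin 3) | z.1 ∈ Set.Ioo 0 t ∧ ‖u z.1 z.2‖ ≤ l} ∩
          {z : ℝ × EuclideanSpace ℝ (Fin 3) | T - ρ ≤ z.1 ∧ dist z.2 x₀ < ρ}) ∧
      ∫ z in ({z : ℝ × EuclideanSpace ℝ (Fin 3) | z.1 ∈ Set.Ioo 0 t ∧ ‖u z.1 z.2‖ ≤ l} ∩
          {z : ℝ × EuclideanSpace ℝ (Fin 3) | T - ρ ≤ z.1 ∧ dist z.2 x₀ < ρ}),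
        |inner ℝ (Literature.Analysis.FluidPDE.curl (u z.1) z.2)
          (fderiv ℝ (u z.1) z.2 (Literature.Analysis.FluidPDE.curl (u z.1) z.2))| ≤ C := by
  set ρ : ℝ := T / 2 with hρ_def
  have hρ0 : 0 < ρ := by positivity
  have hρT : ρ < T := by rw [hρ_def]; linarith
  obtain ⟨C, hC⟩ := hnear ρ hρ0 hρT (‖x₀‖ + ρ)
  refine ⟨ρ, hρ0, C, fun t ht => ?_⟩
  have hsub : ({z : ℝ × EuclideanSpace ℝ (Fin 3) | z.1 ∈ Set.Ioo 0 t ∧ ‖u z.1 z.2‖ ≤ l} ∩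
      {z : ℝ × EuclideanSpace ℝ (Fin 3) | T - ρ ≤ z.1 ∧ dist z.2 x₀ < ρ}) ⊆
      ({z : ℝ × EuclideanSpace ℝ (Fin 3) | z.1 ∈ Set.Ioo 0 t ∧ ‖u z.1 z.2‖ ≤ l} ∩
        {z : ℝ × EuclideanSpace ℝ (Fin 3) | T - ρ ≤ z.1 ∧ ‖z.2‖ < ‖x₀‖ + ρ}) := by
    rintro z ⟨hzS, hzT, hzx⟩
    refine ⟨hzS, hzT, ?_⟩
    have h1 : ‖z.2‖ ≤ ‖z.2 - x₀‖ + ‖x₀‖ := norm_le_norm_sub_add _ _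
    rw [dist_eq_norm] at hzx
    change ‖z.2‖ < ‖x₀‖ + ρ
    linarith
  obtain ⟨hint, hle⟩ := hC t ht
  exact ⟨hint.mono_set hsub,
    (setIntegral_mono_set hint.abs (ae_of_all _ fun z => abs_nonneg _) hsub.eventuallyLE).trans hle⟩

/-! ## The near-field stub is equivalent to the singular-germ statement -/

/-- **The open stub of line `near_field` ⟺ the singular-germ statement.**  The statement of
`stub_nearFieldSlowProductionMaximal` (absolute near-field budgets of maximal solutions for all
levels, layers and radii) is EQUIVALENT to: at every level `l`, every singular, `l`-slow-accumulating
point `(x₀, T)` of a maximal solution has a parabolic germ of the slow class with finite absolute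
production (`germBudget_of_nearFieldBudget` one way, `nearFieldBudget_of_singularGermBudget` the
other). [folklore] -/
theorem nearFieldBudget_iff_singularGermBudget :
    (∀ (ν T : ℝ), 0 < ν → 0 < T →
      ∀ (u : ℝ → EuclideanSpace ℝ (Fin 3) → EuclideanSpace ℝ (Fin 3))
        (p : ℝ → EuclideanSpace ℝ (Fin 3) → ℝ),
        Literature.Analysis.FluidPDE.IsMaximalSmoothSolution ν 0 u p T →
        Literature.Analysis.FluidPDE.IsLerayHopfOn T ν 0 (u 0) u →
        Literature.Analysis.FluidPDE.HasRapidSpatialDecay (u 0) →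
        ∀ l : ℝ, 0 < l → ∀ h : ℝ, 0 < h → h < T → ∀ R : ℝ, ∃ C : ℝ, ∀ t ∈ Set.Ico 0 T,
          MeasureTheory.IntegrableOn
            (fun z : ℝ × EuclideanSpace ℝ (Fin 3) =>
              inner ℝ (Literature.Analysis.FluidPDE.curl (u z.1) z.2)
                (fderiv ℝ (u z.1) z.2 (Literature.Analysis.FluidPDE.curl (u z.1) z.2)))
            ({z : ℝ × EuclideanSpace ℝ (Fin 3) | z.1 ∈ Set.Ioo 0 t ∧ ‖u z.1 z.2‖ ≤ l} ∩
              {z : ℝ × EuclideanSpace ℝ (Fin 3) | T - h ≤ z.1 ∧ ‖z.2‖ < R}) ∧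
          ∫ z in ({z : ℝ × EuclideanSpace ℝ (Fin 3) | z.1 ∈ Set.Ioo 0 t ∧ ‖u z.1 z.2‖ ≤ l} ∩
              {z : ℝ × EuclideanSpace ℝ (Fin 3) | T - h ≤ z.1 ∧ ‖z.2‖ < R}),
            |inner ℝ (Literature.Analysis.FluidPDE.curl (u z.1) z.2)
              (fderiv ℝ (u z.1) z.2 (Literature.Analysis.FluidPDE.curl (u z.1) z.2))| ≤ C) ↔
    (∀ (ν T : ℝ), 0 < ν → 0 < T →
      ∀ (u : ℝ → EuclideanSpace ℝ (Fin 3) → EuclideanSpace ℝ (Fin 3))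
        (p : ℝ → EuclideanSpace ℝ (Fin 3) → ℝ),
        Literature.Analysis.FluidPDE.IsMaximalSmoothSolution ν 0 u p T →
        Literature.Analysis.FluidPDE.IsLerayHopfOn T ν 0 (u 0) u →
        Literature.Analysis.FluidPDE.HasRapidSpatialDecay (u 0) →
        ∀ l : ℝ, 0 < l → ∀ x₀ : EuclideanSpace ℝ (Fin 3),
          (∀ r : ℝ, 0 < r → r ^ 2 < T →
            eLpNorm (Function.uncurry u) ⊤ (MeasureTheory.volume.restrict
              (Literature.Analysis.FluidPDE.parabolicCylinder r ((T : ℝ), x₀))) = ⊤) →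
          (∀ ρ : ℝ, 0 < ρ → ∃ t ∈ Set.Ico 0 T,
            ({z : ℝ × EuclideanSpace ℝ (Fin 3) | z.1 ∈ Set.Ioo 0 t ∧ ‖u z.1 z.2‖ ≤ l} ∩
              {z : ℝ × EuclideanSpace ℝ (Fin 3) | T - ρ ≤ z.1 ∧ dist z.2 x₀ < ρ}).Nonempty) →
          ∃ ρ : ℝ, 0 < ρ ∧ ∃ C : ℝ, ∀ t ∈ Set.Ico 0 T,
            MeasureTheory.IntegrableOn
              (fun z : ℝ × EuclideanSpace ℝ (Fin 3) =>
                inner ℝ (Literature.Analysis.FluidPDE.curl (u z.1) z.2)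
                  (fderiv ℝ (u z.1) z.2 (Literature.Analysis.FluidPDE.curl (u z.1) z.2)))
              ({z : ℝ × EuclideanSpace ℝ (Fin 3) | z.1 ∈ Set.Ioo 0 t ∧ ‖u z.1 z.2‖ ≤ l} ∩
                {z : ℝ × EuclideanSpace ℝ (Fin 3) | T - ρ ≤ z.1 ∧ dist z.2 x₀ < ρ}) ∧
            ∫ z in ({z : ℝ × EuclideanSpace ℝ (Fin 3) | z.1 ∈ Set.Ioo 0 t ∧ ‖u z.1 z.2‖ ≤ l} ∩
                {z : ℝ × EuclideanSpace ℝ (Fin 3) | T - ρ ≤ z.1 ∧ dist z.2 x₀ < ρ}),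
              |inner ℝ (Literature.Analysis.FluidPDE.curl (u z.1) z.2)
                (fderiv ℝ (u z.1) z.2 (Literature.Analysis.FluidPDE.curl (u z.1) z.2))| ≤ C) := by
  constructor
  · intro hN ν T hν hT u p hmax hLH hdec l hl x₀ _ _
    exact germBudget_of_nearFieldBudget hT (hN ν T hν hT u p hmax hLH hdec l hl) x₀
  · intro hG ν T hν hT u p hmax hLH hdec l hl
    exact nearFieldBudget_of_singularGermBudget hν hT hmax.1 hLH hdec (hG ν T hν hT u p hmax hLH hdec l hl)

/-! ## The crux is implied by no blow-up -/

/-- **No blow-up ⇒ `SlowClassProduction`.**  If every classical solution of unforced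
Navier–Stokes on `ℝ³ × [0,T)` that is Leray–Hopf on `[0,T]` from its rapidly decaying datum extends
smoothly past `T` (the hypothesis of the tree's `navierStokesRegularity_of_noBlowup`, item
stmt-NavierStokesRegularity-0055), then the crux holds — by the landed
`slowClassBudget_of_hasSmoothExtensionPast` (Fatou at `t = T` + Tao persistence for the extension).
So the crux sits between "no blow-up" and (with the route's other cruxes, `Theses.HodographBetchov.closes`)
Clay (A): refuting it refutes the no-blow-up statement. [cite: Tao2011, Cor. 11.1] -/
theorem slowClassProduction_of_noBlowup
    (hNB : ∀ (ν T : ℝ), 0 < ν → 0 < T →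
      ∀ (u : ℝ → EuclideanSpace ℝ (Fin 3) → EuclideanSpace ℝ (Fin 3))
        (p : ℝ → EuclideanSpace ℝ (Fin 3) → ℝ),
        Literature.Analysis.FluidPDE.IsClassicalNSSolutionOn (Set.Ico 0 T) ν 0 u p →
        Literature.Analysis.FluidPDE.IsLerayHopfOn T ν 0 (u 0) u →
        Literature.Analysis.FluidPDE.HasRapidSpatialDecay (u 0) →
        Literature.Analysis.FluidPDE.HasSmoothExtensionPast ν 0 u T) :
    Summit.NavierStokesRegularity.NavierStokesRegularity.Theses.HodographBetchov.SlowClassProduction :=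
  fun ν T hν hT u p hcl hLH hdec l hl =>
    slowClassBudget_of_hasSmoothExtensionPast hν hT hLH hdec (hNB ν T hν hT u p hcl hLH hdec) l hl

end Summit.NavierStokesRegularity.NavierStokesRegularity.Theorems.SlowClassProduction.NearField

end
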